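import Summits.QuantumFields.BalabanUV.T4Continuum.Support.NE7K1LinWalkLineHcomm
import Summits.QuantumFields.BalabanUV.T4Continuum.Support.NE7K1LinTwoRunUpper
import Summits.QuantumFields.BalabanUV.T4Continuum.Support.NE7K1LinSchurBilinError
import Summits.QuantumFields.BalabanUV.T4Continuum.Support.NE7K1LinWalkDeltaRegion

/-!
# NE7K1LinSchurKernelDecay — row NE7 (node U5), candidate route HOM, path H1L, cell K1-lin(s): THE SCHUR COMPLEMENT `K_L` IS AN EXPONENTIALLY
# LOCALISED SECOND-ORDER OPERATOR — fixed-`L` entry decay of run B's Schur complement onto block means at U = 1, A = 0, mesh-uniformly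
# (NEEDS-ESTIMATE #E1 «REG-LINE(s)»'s input I3 of lens 2, at one scale)

Lineage `b2b-balaban-t4-ne7-p2` (CRUX PROVER NE7 #2), generation 71; file 28.  PRICING-NE7 v28 (§207 (h), desk note N-28-1) books
NEEDS-ESTIMATE #E1 «REG-LINE(s)»: the regularity half of B4 (1.10) for the K1-lin(s) line `T(s) = (1−s)P_A + s·P_B^{Schur}` on the `η_A`
lattice, where `−D_s = (1−s)(−Δ^{η_A}) + s·K_L` is translation-invariant and the ONE non-verbatim input is the localisation of `K_L` = the
Schur complement of `L^{2−(d+1)}(−Δ^{η_B})` onto `L`-block means (lens 2's I3 «fixed-L entry decay of K_L», t4-ne7-idea-2 g57).  THIS FILE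
proves it at one scale ([folklore]; Combes–Thomas on the fluctuation block):

* §1 THE FLUCTUATION BLOCK `D = (H_B)₂₂` (in-block fluctuation labels `↥Ω × NZ d L`, `Ω = R′.image (blk L)`): coercive with floor
  `2n²∕L^{d+1}` (`fluct_coercive`, from `NE7K1LinWalkLine.runB_form_ge_fluct`), entries `≤ 8(d+1)(nL)²∕L^{d+1}` coupling only labels over equal
  or ADJACENT coarse sites (`NE7K1LinWalkLineEntries`), hence the conjugation error of the site weight `θ·|site p − site q₀|_∞` is
  `≤ (e^θ − 1)·16(d+1)²n²L²·‖w‖²` (`fluct_conjError_le`, by the sparse-matrix bound of file 11) and **`fluct_inv_entry_decay`**: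
  `|D⁻¹(p,q)| ≤ (L^{d+1}∕n²)·e^{−θ|site p − site q|_∞}` whenever `16(d+1)²L^{d+3}(e^θ − 1) ≤ 1` — `Beta.CombesThomasForm.combesThomas_form`
  BY NAME; the rate condition is FREE of the mesh `n`.
* §2 **`schur_correction_entry_decay`** — the non-local part of run B's Schur complement: for every `a ≥ 0` and all coarse sites `x, y`,
  `|((H_B)₁₂D⁻¹(H_B)₂₁)(x,y)| ≤ n²·C_K(d,L)·e^{−θ(|x − y|_∞ − 2)}`, `C_K = 64(d+1)²·9^{d+1}·L^{d+5}` (the two border factors couple `x`, `y` to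
  labels over sites at sup-distance `≤ 1`, at most `3^{d+1}L^{d+1}` of them); **`twoCutoffLine_one_entry_decay`** — at `a = 0` the local part
  `(H_B)₁₁ = P_A + (L−1)·lap` has range one, so `K_L = twoCutoffLine … n 0 1` (`NE7K1LinTwoRunUpper.twoCutoffLine_one`) satisfies
  `|K_L(x,y)| ≤ n²·C_K(d,L)·e^{−θ(|x − y|_∞ − 2)}` for `|x − y|_∞ ≥ 2`: a FIXED-`L`, MESH-UNIFORM exponential localisation of the second-order
  operator `K_L` (its entries are `O(n²)` like `−Δ^{η_A}`'s), rate `θ = θ_K(d,L)` with `e^{θ_K} − 1 = 1∕(16(d+1)²L^{d+3})` admissible.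

HONEST FRAMING: [folklore]; ONE scale (the block-RG trajectory of the symbol — #E1's per-scale input — is NOT iterated here), A = 0, U = 1,
crude explicit constants (lens 2's numerical rate κ₀ ≥ 1.2 at L = 2 is far better than `θ_K`); the symbol window `−Δ ⪯ K_L ⪯ 3(6∕5)^d(−Δ)`
is files §3j ∕ §3l BY NAME, not restated; nothing of Bałaban's asserted; no `sorry`.  Census only (an input of NEEDS-ESTIMATE #E1 at one scale;
#E1 stays OPEN; cell K1-lin(s) TAG ∕ SIZE per PRICING-NE7 v28 unchanged); NE7 NOT PRINTED ∕ NOT PROVED; spine 0∕9; FIXED FINITE T⁴, rung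
(B)+1; NOT infinite volume, NOT mass gap, NOT Clay.  HONEST DEPENDENCY: continuum YM on T⁴ ⇐ BetaPertH ∧ nine spine estimates (0/9 proved);
BetaPertH ⇐ (D1) ∧ (D4) ∧ CAP+tail; G-an2-4 gates asym, D1 and NE2/3/4.
-/

noncomputable section

open Finset Matrix

namespace Summit.QuantumFields.BalabanUV.T4Continuum.NE7K1LinSchurKernelDecay

open Literature.MathematicalPhysics.QuantumFieldTheory.Balaban1983to89
open Literature.MathematicalPhysics.QuantumFieldTheory.Balaban1983to89.B4ContourShift (supNorm supNorm_nonneg abs_le_supNorm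
  exists_supNorm_eq)
open Literature.MathematicalPhysics.QuantumFieldTheory.Balaban1983to89.B4Reflection242
open Literature.MathematicalPhysics.QuantumFieldTheory.Balaban1983to89.B4BoxCov237
open Literature.MathematicalPhysics.QuantumFieldTheory.Balaban1983to89.B4Lower18
open Literature.MathematicalPhysics.QuantumFieldTheory.Balaban1983to89.Beta.CombesThomasForm (combesThomas_form abs_exp_sub_one_le)
open NE7K1LinBlockCoords NE7K1LinSchurLineU1 NE7K1LinSchurLineForm NE7K1LinWalkLine NE7K1LinWalkLineEntries NE7K1LinWalkLineBlocks
  NE7K1LinTwoRunUpper NE7K1LinSchurBilinError NE7K1LinWalkDeltaRegion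

variable {d : ℕ} {n L : ℕ} [NeZero L] {R' : Finset (Fin (d + 1) → ℤ)}

/-! ### §0 Sup-distance bookkeeping on the coarse sites -/

omit [NeZero L] in
/-- `|x − y|_∞ ≤ 1` when every coordinate differs by at most one. [folklore] -/
theorem supNorm_sub_le_one_of_cubeAdj {x y : Fin (d + 1) → ℤ} (h : ∀ μ, |x μ - y μ| ≤ 1) : supNorm (x - y) ≤ 1 := by
  obtain ⟨i, hi⟩ := exists_supNorm_eq (x - y)
  rw [hi]
  have := h i
  have : ((|x i - y i| : ℤ) : ℝ) ≤ 1 := by exact_mod_cast this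
  simpa using this

omit [NeZero L] in
/-- a nonzero coupling of `H_B` between a coarse coordinate and a fluctuation label happens within sup-distance one. [folklore] -/
theorem cubeAdj_of_eq_or_mem_nbrs {x z : Fin (d + 1) → ℤ} (h : x = z ∨ z ∈ nbrs x) : ∀ μ, |x μ - z μ| ≤ 1 := by
  intro μ
  rcases h with rfl | hz
  · simp
  · rw [abs_sub_comm]; exact abs_sub_le_one_of_mem_nbrs hz μ

omit [NeZero L] in
/-- the triangle inequality behind «walks through the two border layers»: `|x − y|_∞ ≤ |p − q|_∞ + 2` when `|x − p|_∞, |q − y|_∞ ≤ 1`. [folklore] -/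
theorem supNorm_sub_ge {x y p q : Fin (d + 1) → ℤ} (hp : supNorm (x - p) ≤ 1) (hq : supNorm (q - y) ≤ 1) :
    supNorm (x - y) - 2 ≤ supNorm (p - q) := by
  have h1 := supNorm_add_le (x - p) (p - q)
  have h2 := supNorm_add_le (x - p + (p - q)) (q - y)
  have e : x - p + (p - q) + (q - y) = x - y := by abel
  rw [e] at h2
  linarith

/-! ### §1 The fluctuation block `D = (H_B)₂₂`: coercivity, sparse entries, conjugation error, Combes–Thomas -/

section Fluct

variable (hn : 1 ≤ n) (hR' : IsBlockUnion (n * L) R') {a : ℝ} (ha : 0 ≤ a)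

include hn ha in
/-- **THE FLUCTUATION FLOOR**: `(2n²∕L^{d+1})‖ψ‖² ≤ ⟨ψ, Dψ⟩` (block Poincaré, `NE7K1LinWalkLine.runB_form_ge_fluct` at `V = 0`). [folklore] -/
theorem fluct_coercive (ψ : ↥(R'.image (blk L)) × NZ d L → ℝ) :
    2 * (n : ℝ) ^ 2 / (L : ℝ) ^ (d + 1) * (ψ ⬝ᵥ ψ) ≤ ψ ⬝ᵥ (runB (isBlockUnion_fine hR') n a).toBlocks₂₂ *ᵥ ψ := by
  rw [← form_inr]
  exact runB_form_ge_fluct hn hR' ha 0 ψ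

include hn hR' in
/-- sparse entries of `D`: `|D(p,q)| ≤ 8(d+1)(nL)²∕L^{d+1}`, and `D(p,q) ≠ 0` with different sites forces ADJACENT sites. [folklore] -/
theorem fluct_entry (p q : ↥(R'.image (blk L)) × NZ d L) :
    |(runB (isBlockUnion_fine hR') n a).toBlocks₂₂ p q| ≤ 8 * ((d : ℝ) + 1) * ((n : ℝ) * L) ^ 2 / (L : ℝ) ^ (d + 1) ∧
      ((runB (isBlockUnion_fine hR') n a).toBlocks₂₂ p q ≠ 0 → p.1 ≠ q.1 → q.1.1 ∈ nbrs p.1.1) := by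
  refine ⟨abs_runB_inr_le hn hR' a (Sum.inr p) q, fun h hne => ?_⟩
  exact mem_nbrs_of_runB_inr_ne_zero hn hR' a (c := Sum.inr p) h hne

include hn hR' in
/-- **THE CONJUGATION ERROR OF THE SITE WEIGHT** `φ = θ·|site · − site q₀|_∞` on `D`: `|Σ_{p,q}(e^{φ_p − φ_q} − 1)D_{pq}w_pw_q| ≤
(e^θ − 1)·16(d+1)²n²L²·‖w‖²` (only adjacent-site pairs contribute; the sparse-matrix bound of file 11 with `2(d+1)L^{d+1}` related labels).
[folklore] -/
theorem fluct_conjError_le {θ : ℝ} (hθ : 0 ≤ θ) (q₀ : ↥(R'.image (blk L)) × NZ d L) (w : ↥(R'.image (blk L)) × NZ d L → ℝ) :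
    |∑ p, ∑ q, (Real.exp (θ * supNorm (p.1.1 - q₀.1.1) - θ * supNorm (q.1.1 - q₀.1.1)) - 1) *
        (runB (isBlockUnion_fine hR') n a).toBlocks₂₂ p q * (w p * w q)| ≤
      (Real.exp θ - 1) * (16 * ((d : ℝ) + 1) ^ 2 * (n : ℝ) ^ 2 * (L : ℝ) ^ 2) * (w ⬝ᵥ w) := by
  classical
  set D := (runB (isBlockUnion_fine hR') n a).toBlocks₂₂ with hD
  set E : Matrix (↥(R'.image (blk L)) × NZ d L) (↥(R'.image (blk L)) × NZ d L) ℝ := Matrix.of fun p q =>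
    (Real.exp (θ * supNorm (p.1.1 - q₀.1.1) - θ * supNorm (q.1.1 - q₀.1.1)) - 1) * D p q with hE
  have hL0 : (0 : ℝ) < L := by exact_mod_cast (NeZero.one_le : 1 ≤ L)
  -- the double sum is `⟨w, Ew⟩`
  have hsum : ∑ p, ∑ q, (Real.exp (θ * supNorm (p.1.1 - q₀.1.1) - θ * supNorm (q.1.1 - q₀.1.1)) - 1) * D p q * (w p * w q) =
      w ⬝ᵥ E *ᵥ w := by
    simp only [dotProduct, mulVec, hE, Matrix.of_apply, Finset.mul_sum]
    exact Finset.sum_congr rfl fun p _ => Finset.sum_congr rfl fun q _ => by ring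
  -- entries of `E`: zero at equal sites or non-adjacent sites, `≤ (e^θ − 1)·θ_D` elsewhere
  set θD : ℝ := 8 * ((d : ℝ) + 1) * ((n : ℝ) * L) ^ 2 / (L : ℝ) ^ (d + 1) with hθD
  have hθD0 : 0 ≤ θD := by rw [hθD]; positivity
  have hEentry : ∀ p q, |E p q| ≤ (Real.exp θ - 1) * θD := by
    intro p q
    simp only [hE, Matrix.of_apply, abs_mul]
    by_cases hpq : p.1 = q.1
    · rw [hpq, sub_self, Real.exp_zero, sub_self, abs_zero, zero_mul]
      exact mul_nonneg (by linarith [Real.add_one_le_exp θ]) hθD0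
    · by_cases hz : D p q = 0
      · rw [hz, abs_zero, mul_zero]; exact mul_nonneg (by linarith [Real.add_one_le_exp θ]) hθD0
      · have hadj : q.1.1 ∈ nbrs p.1.1 := (fluct_entry hn hR' (a := a) p q).2 hz hpq
        refine mul_le_mul ?_ ((fluct_entry hn hR' (a := a) p q).1) (abs_nonneg _) (by linarith [Real.add_one_le_exp θ])
        refine abs_exp_sub_one_le ?_
        have h1 : |supNorm (p.1.1 - q₀.1.1) - supNorm (q.1.1 - q₀.1.1)| ≤ supNorm (p.1.1 - q.1.1) := by
          have := abs_edistR_sub_le (n := 1) p.1 q.1 q₀.1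
          simpa [edistR] using this
        have h2 : supNorm (p.1.1 - q.1.1) ≤ 1 := supNorm_sub_le_one_of_mem_nbrs hadj
        rw [← mul_sub, abs_mul, abs_of_nonneg hθ]
        nlinarith [h1, h2, abs_nonneg (supNorm (p.1.1 - q₀.1.1) - supNorm (q.1.1 - q₀.1.1))]
  have hErel : ∀ p q, E p q ≠ 0 → q.1.1 ∈ nbrs p.1.1 := by
    intro p q h
    simp only [hE, Matrix.of_apply] at h
    have hz : D p q ≠ 0 := right_ne_zero_of_mul h
    have hpq : p.1 ≠ q.1 := by
      intro hpq
      apply h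
      rw [hpq, sub_self, Real.exp_zero, sub_self, zero_mul]
    exact (fluct_entry hn hR' (a := a) p q).2 hz hpq
  -- the sparse bound `‖Ew‖² ≤ ((e^θ−1)θ_D)²·(2(d+1)L^{d+1})²·‖w‖²`, then Cauchy–Schwarz
  have hsp := mulVec_sq_le_of_sparse E (fun p q : ↥(R'.image (blk L)) × NZ d L => q.1.1 ∈ nbrs p.1.1) hEentry hErel
    (by positivity)
    (fun p => card_filter_fst_le (fun b' : ↥(R'.image (blk L)) => b'.1 ∈ nbrs p.1.1) (card_filter_nbrs_le p.1.1).1)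
    (fun q => card_filter_fst_le (fun b' : ↥(R'.image (blk L)) => q.1.1 ∈ nbrs b'.1) (card_filter_nbrs_le q.1.1).2) w
  have hww : 0 ≤ w ⬝ᵥ w := Finset.sum_nonneg fun i _ => mul_self_nonneg _
  have hcs : (w ⬝ᵥ E *ᵥ w) ^ 2 ≤ (w ⬝ᵥ w) * (E *ᵥ w ⬝ᵥ E *ᵥ w) := by
    have := Finset.sum_mul_sq_le_sq_mul_sq (Finset.univ) w (E *ᵥ w)
    simp only [dotProduct, ← sq] at this ⊢
    exact this
  set K : ℝ := (Real.exp θ - 1) * θD * (2 * ((d : ℝ) + 1) * (L : ℝ) ^ (d + 1)) with hK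
  have hK0 : 0 ≤ K := by rw [hK]; exact mul_nonneg (mul_nonneg (by linarith [Real.add_one_le_exp θ]) hθD0) (by positivity)
  have hsq : (w ⬝ᵥ E *ᵥ w) ^ 2 ≤ (K * (w ⬝ᵥ w)) ^ 2 := by
    refine hcs.trans ?_
    have h3 : E *ᵥ w ⬝ᵥ E *ᵥ w ≤ K ^ 2 * (w ⬝ᵥ w) := hsp.trans (le_of_eq (by rw [hK]; ring))
    nlinarith [h3, hww]
  have habs : |w ⬝ᵥ E *ᵥ w| ≤ K * (w ⬝ᵥ w) := abs_le_of_sq_le_sq' hsq (mul_nonneg hK0 hww) |>.2 |> fun h =>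
    abs_le.2 ⟨(abs_le_of_sq_le_sq' hsq (mul_nonneg hK0 hww)).1, h⟩
  rw [hsum]
  refine habs.trans (le_of_eq ?_)
  rw [hK, hθD]
  field_simp
  ring

include hn hR' ha in
/-- **COMBES–THOMAS FOR THE FLUCTUATION BLOCK**: if `16(d+1)²L^{d+3}(e^θ − 1) ≤ 1` (`θ ≥ 0`; a condition FREE of the mesh) then
`|D⁻¹(p,q)| ≤ (L^{d+1}∕n²)·e^{−θ|site p − site q|_∞}`. [cite: Balaban1983RegularityDecay, §2 Lemma 2.1 «L²-bounds of the cube operators», shape at A = 0] [folklore] -/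
theorem fluct_inv_entry_decay {θ : ℝ} (hθ : 0 ≤ θ)
    (hθs : 16 * ((d : ℝ) + 1) ^ 2 * (L : ℝ) ^ (d + 3) * (Real.exp θ - 1) ≤ 1) (p q : ↥(R'.image (blk L)) × NZ d L) :
    |((runB (isBlockUnion_fine hR') n a).toBlocks₂₂)⁻¹ p q| ≤
      (L : ℝ) ^ (d + 1) / (n : ℝ) ^ 2 * Real.exp (-(θ * supNorm (p.1.1 - q.1.1))) := by
  set D := (runB (isBlockUnion_fine hR') n a).toBlocks₂₂ with hD
  have hL0 : (0 : ℝ) < L := by exact_mod_cast (NeZero.one_le : 1 ≤ L)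
  have hn0 : (0 : ℝ) < n := by exact_mod_cast hn
  have hσ : 0 < 2 * (n : ℝ) ^ 2 / (L : ℝ) ^ (d + 1) := by positivity
  have hpos : ∀ ω, 2 * (n : ℝ) ^ 2 / (L : ℝ) ^ (d + 1) * (ω ⬝ᵥ ω) ≤ ω ⬝ᵥ D.mulVec ω := fluct_coercive hn hR' ha
  -- the conjugation error is at most half the floor
  have herr : ∀ w, -(2 * (n : ℝ) ^ 2 / (L : ℝ) ^ (d + 1) / 2) * (w ⬝ᵥ w) ≤
      ∑ j, ∑ k, (Real.exp (θ * supNorm (j.1.1 - q.1.1) - θ * supNorm (k.1.1 - q.1.1)) - 1) * D j k * (w j * w k) := by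
    intro w
    have h := fluct_conjError_le hn hR' (a := a) hθ q w
    have hww : 0 ≤ w ⬝ᵥ w := Finset.sum_nonneg fun i _ => mul_self_nonneg _
    have hsmall : (Real.exp θ - 1) * (16 * ((d : ℝ) + 1) ^ 2 * (n : ℝ) ^ 2 * (L : ℝ) ^ 2) ≤
        2 * (n : ℝ) ^ 2 / (L : ℝ) ^ (d + 1) / 2 := by
      rw [div_div, le_div_iff₀ (by positivity)]
      have e : (Real.exp θ - 1) * (16 * ((d : ℝ) + 1) ^ 2 * (n : ℝ) ^ 2 * (L : ℝ) ^ 2) * ((L : ℝ) ^ (d + 1) * 2) =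
          (16 * ((d : ℝ) + 1) ^ 2 * (L : ℝ) ^ (d + 3) * (Real.exp θ - 1)) * (2 * (n : ℝ) ^ 2) := by ring
      rw [e]
      nlinarith [hθs, sq_nonneg (n : ℝ)]
    have := (abs_le.1 h).1
    nlinarith [this, hsmall, hww]
  -- `D` is invertible and its columns solve `D v = e_q`
  have hDunit : IsUnit D.det := isUnit_det_of_coercive D hσ hpos
  have hv : D.mulVec (fun i => D⁻¹ i q) = Pi.single q 1 := by
    funext j
    have : (D.mulVec fun i => D⁻¹ i q) j = (D * D⁻¹) j q := by simp [mulVec, dotProduct, Matrix.mul_apply]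
    rw [this, mul_nonsing_inv D hDunit, Matrix.one_apply, Pi.single_apply]
  have h := combesThomas_form D _ (fun j : ↥(R'.image (blk L)) × NZ d L => θ * supNorm (j.1.1 - q.1.1)) hσ hpos herr q _ hv p
  simp only [sub_self, B4BoxCov237.supNorm_zero', mul_zero, sub_zero] at h
  refine h.trans (le_of_eq ?_)
  congr 1
  field_simp

end Fluct

/-! ### §2 The Schur complement's non-local part decays; `K_L` at `a = 0` -/

section Schur

variable (hn : 1 ≤ n) (hR' : IsBlockUnion (n * L) R') {a : ℝ} (ha : 0 ≤ a)

omit [NeZero L] in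
/-- a coarse predicate with at most `m` solutions has at most `m·L^{d+1}` solutions among the fluctuation labels. [folklore] -/
theorem card_filter_fst_le' [NeZero L] (P : ↥(R'.image (blk L)) → Prop) [DecidablePred P] {m : ℝ}
    (hP : ((univ.filter P).card : ℝ) ≤ m) :
    ((univ.filter fun q : ↥(R'.image (blk L)) × NZ d L => P q.1).card : ℝ) ≤ m * (L : ℝ) ^ (d + 1) := by
  classical
  have e : (univ.filter fun q : ↥(R'.image (blk L)) × NZ d L => P q.1) = (univ.filter P) ×ˢ (univ : Finset (NZ d L)) := by
    rw [← Finset.filter_product_left (s := (univ : Finset ↥(R'.image (blk L)))) (t := (univ : Finset (NZ d L))) P,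
      Finset.univ_product_univ]
  rw [e, Finset.card_product, Finset.card_univ]
  have hNZ : (Fintype.card (NZ d L) : ℝ) ≤ (L : ℝ) ^ (d + 1) := by linarith [NE7K1LinSchurLineU1Sharp.card_NZ_succ_le (d := d) (L := L)]
  have hm : 0 ≤ m := le_trans (Nat.cast_nonneg _) hP
  push_cast
  exact mul_le_mul hP hNZ (Nat.cast_nonneg _) hm

omit [NeZero L] in
/-- at most `3^{d+1}` coarse sites lie within sup-distance one of a given site. [folklore] -/
theorem card_filter_cubeAdj_le (x : ↥(R'.image (blk L))) :
    ((univ.filter fun b : ↥(R'.image (blk L)) => ∀ μ, |x.1 μ - b.1 μ| ≤ 1).card : ℝ) ≤ (3 : ℝ) ^ (d + 1) := by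
  classical
  have h := B4RandomWalk213.card_cubeAdj_le (fun b : ↥(R'.image (blk L)) => b.1) Subtype.val_injective x
  exact_mod_cast h

include hn hR' ha in
/-- **THE NON-LOCAL PART OF RUN B's SCHUR COMPLEMENT DECAYS EXPONENTIALLY, MESH-UNIFORMLY**: for `a ≥ 0`, `θ ≥ 0` with
`16(d+1)²L^{d+3}(e^θ − 1) ≤ 1` and all coarse sites `x, y`:
`|((H_B)₁₂·D⁻¹·(H_B)₂₁)(x,y)| ≤ n²·64(d+1)²·9^{d+1}·L^{d+5}·e^{−θ(|x − y|_∞ − 2)}`. [folklore] -/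
theorem schur_correction_entry_decay {θ : ℝ} (hθ : 0 ≤ θ)
    (hθs : 16 * ((d : ℝ) + 1) ^ 2 * (L : ℝ) ^ (d + 3) * (Real.exp θ - 1) ≤ 1) (x y : ↥(R'.image (blk L))) :
    |((runB (isBlockUnion_fine hR') n a).toBlocks₁₂ * ((runB (isBlockUnion_fine hR') n a).toBlocks₂₂)⁻¹ *
        (runB (isBlockUnion_fine hR') n a).toBlocks₂₁) x y| ≤
      (n : ℝ) ^ 2 * (64 * ((d : ℝ) + 1) ^ 2 * (9 : ℝ) ^ (d + 1) * (L : ℝ) ^ (d + 5)) *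
        Real.exp (-(θ * (supNorm (x.1 - y.1) - 2))) := by
  classical
  set H := runB (isBlockUnion_fine hR') n a with hH
  have hL0 : (0 : ℝ) < L := by exact_mod_cast (NeZero.one_le : 1 ≤ L)
  have hn0 : (0 : ℝ) < n := by exact_mod_cast hn
  set θD : ℝ := 8 * ((d : ℝ) + 1) * ((n : ℝ) * L) ^ 2 / (L : ℝ) ^ (d + 1) with hθD
  have hθD0 : 0 ≤ θD := by rw [hθD]; positivity
  set Kq : ℝ := (L : ℝ) ^ (d + 1) / (n : ℝ) ^ 2 * Real.exp (-(θ * (supNorm (x.1 - y.1) - 2))) with hKq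
  have hKq0 : 0 ≤ Kq := by rw [hKq]; positivity
  -- the entry as a double sum, bounded termwise
  rw [Matrix.mul_apply]
  simp_rw [Matrix.mul_apply, Finset.sum_mul]
  have hterm : ∀ q p, |H.toBlocks₁₂ x p * (H.toBlocks₂₂)⁻¹ p q * H.toBlocks₂₁ q y| ≤
      (if (∀ μ, |x.1 μ - p.1.1 μ| ≤ 1) then (1 : ℝ) else 0) * (if (∀ μ, |y.1 μ - q.1.1 μ| ≤ 1) then (1 : ℝ) else 0) *
        (θD * Kq * θD) := by
    intro q p
    by_cases h12 : H.toBlocks₁₂ x p = 0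
    · rw [h12, zero_mul, zero_mul, abs_zero]; positivity
    by_cases h21 : H.toBlocks₂₁ q y = 0
    · rw [h21, mul_zero, abs_zero]; positivity
    -- both border factors are nonzero: the labels sit within sup-distance one of `x` resp. `y`
    have hxp : ∀ μ, |x.1 μ - p.1.1 μ| ≤ 1 := by
      refine cubeAdj_of_eq_or_mem_nbrs ?_
      by_cases he : x = p.1
      · exact Or.inl (congrArg Subtype.val he)
      · exact Or.inr (mem_nbrs_of_runB_inr_ne_zero hn hR' a (c := Sum.inl x) h12 he)
    have hyq : ∀ μ, |y.1 μ - q.1.1 μ| ≤ 1 := by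
      refine cubeAdj_of_eq_or_mem_nbrs ?_
      by_cases he : y = q.1
      · exact Or.inl (congrArg Subtype.val he)
      · exact Or.inr (nbrs_comm.1 (mem_nbrs_of_runB_inr_ne_zero' hn hR' a (c := Sum.inl y) h21 (Ne.symm he)))
    rw [if_pos hxp, if_pos hyq, one_mul, one_mul, abs_mul, abs_mul]
    have hD : |(H.toBlocks₂₂)⁻¹ p q| ≤ Kq := by
      refine (fluct_inv_entry_decay hn hR' ha hθ hθs p q).trans ?_
      rw [hKq]
      refine mul_le_mul_of_nonneg_left (Real.exp_le_exp.2 ?_) (by positivity)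
      have hge := supNorm_sub_ge (supNorm_sub_le_one_of_cubeAdj hxp)
        (by rw [← neg_sub, B4TorusKernel.supNorm_neg]; exact supNorm_sub_le_one_of_cubeAdj hyq : supNorm (q.1.1 - y.1) ≤ 1)
      nlinarith [hge, hθ]
    have h1 : |H.toBlocks₁₂ x p| ≤ θD := abs_runB_inr_le hn hR' a (Sum.inl x) p
    have h2 : |H.toBlocks₂₁ q y| ≤ θD := abs_runB_inr_le' hn hR' a q (Sum.inl y)
    calc |H.toBlocks₁₂ x p| * |(H.toBlocks₂₂)⁻¹ p q| * |H.toBlocks₂₁ q y| ≤ θD * Kq * θD :=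
          mul_le_mul (mul_le_mul h1 hD (abs_nonneg _) hθD0) h2 (abs_nonneg _) (mul_nonneg hθD0 hKq0)
      _ = θD * Kq * θD := rfl
  refine (Finset.abs_sum_le_sum_abs _ _).trans ?_
  refine (Finset.sum_le_sum fun q _ => (Finset.abs_sum_le_sum_abs _ _).trans (Finset.sum_le_sum fun p _ => hterm q p)).trans ?_
  -- the counting: `Σ_q Σ_p 1_{P₁ p}1_{P₂ q}·K = #P₁·#P₂·K`
  have hcount₁ : ((univ.filter fun p : ↥(R'.image (blk L)) × NZ d L => ∀ μ, |x.1 μ - p.1.1 μ| ≤ 1).card : ℝ) ≤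
      (3 : ℝ) ^ (d + 1) * (L : ℝ) ^ (d + 1) :=
    card_filter_fst_le' (fun b : ↥(R'.image (blk L)) => ∀ μ, |x.1 μ - b.1 μ| ≤ 1) (card_filter_cubeAdj_le x)
  have hcount₂ : ((univ.filter fun q : ↥(R'.image (blk L)) × NZ d L => ∀ μ, |y.1 μ - q.1.1 μ| ≤ 1).card : ℝ) ≤
      (3 : ℝ) ^ (d + 1) * (L : ℝ) ^ (d + 1) :=
    card_filter_fst_le' (fun b : ↥(R'.image (blk L)) => ∀ μ, |y.1 μ - b.1 μ| ≤ 1) (card_filter_cubeAdj_le y)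
  have hsum : ∑ q : ↥(R'.image (blk L)) × NZ d L, ∑ p : ↥(R'.image (blk L)) × NZ d L,
      (if (∀ μ, |x.1 μ - p.1.1 μ| ≤ 1) then (1 : ℝ) else 0) * (if (∀ μ, |y.1 μ - q.1.1 μ| ≤ 1) then (1 : ℝ) else 0) *
        (θD * Kq * θD) =
      ((univ.filter fun p : ↥(R'.image (blk L)) × NZ d L => ∀ μ, |x.1 μ - p.1.1 μ| ≤ 1).card : ℝ) *
        ((univ.filter fun q : ↥(R'.image (blk L)) × NZ d L => ∀ μ, |y.1 μ - q.1.1 μ| ≤ 1).card : ℝ) * (θD * Kq * θD) := by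
    have e1 : ∀ q : ↥(R'.image (blk L)) × NZ d L, ∑ p : ↥(R'.image (blk L)) × NZ d L,
        (if (∀ μ, |x.1 μ - p.1.1 μ| ≤ 1) then (1 : ℝ) else 0) * (if (∀ μ, |y.1 μ - q.1.1 μ| ≤ 1) then (1 : ℝ) else 0) *
          (θD * Kq * θD) =
        ((univ.filter fun p : ↥(R'.image (blk L)) × NZ d L => ∀ μ, |x.1 μ - p.1.1 μ| ≤ 1).card : ℝ) *
          ((if (∀ μ, |y.1 μ - q.1.1 μ| ≤ 1) then (1 : ℝ) else 0) * (θD * Kq * θD)) := by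
      intro q
      rw [← Finset.sum_mul, ← Finset.sum_mul, mul_assoc]
      congr 1
      rw [Finset.sum_boole]
    simp_rw [e1]
    rw [← Finset.mul_sum, ← Finset.sum_mul, Finset.sum_boole]
    ring
  rw [hsum]
  have hK0 : 0 ≤ θD * Kq * θD := by positivity
  calc ((univ.filter fun p : ↥(R'.image (blk L)) × NZ d L => ∀ μ, |x.1 μ - p.1.1 μ| ≤ 1).card : ℝ) *
        ((univ.filter fun q : ↥(R'.image (blk L)) × NZ d L => ∀ μ, |y.1 μ - q.1.1 μ| ≤ 1).card : ℝ) * (θD * Kq * θD)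
      ≤ ((3 : ℝ) ^ (d + 1) * (L : ℝ) ^ (d + 1)) * ((3 : ℝ) ^ (d + 1) * (L : ℝ) ^ (d + 1)) * (θD * Kq * θD) :=
        mul_le_mul_of_nonneg_right (mul_le_mul hcount₁ hcount₂ (Nat.cast_nonneg _) (by positivity)) hK0
    _ = (n : ℝ) ^ 2 * (64 * ((d : ℝ) + 1) ^ 2 * (9 : ℝ) ^ (d + 1) * (L : ℝ) ^ (d + 5)) *
        Real.exp (-(θ * (supNorm (x.1 - y.1) - 2))) := by
        rw [hθD, hKq, show (9 : ℝ) ^ (d + 1) = (3 : ℝ) ^ (d + 1) * (3 : ℝ) ^ (d + 1) by rw [← mul_pow]; norm_num]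
        field_simp
        ring

include hn hR' in
/-- at `a = 0` the local part `(H_B)₁₁` has range one: `(H_B)₁₁(x,y) = 0` unless `|x − y|_∞ ≤ 1`. [folklore] -/
theorem toBlocks₁₁_eq_zero_of_far (x y : ↥(R'.image (blk L))) (hfar : ¬ ∀ μ, |x.1 μ - y.1 μ| ≤ 1) :
    (runB (isBlockUnion_fine hR') n (0 : ℝ)).toBlocks₁₁ x y = 0 := by
  classical
  have hxy : x ≠ y := fun h => hfar (by intro μ; rw [h]; simp)
  have hnb : y.1 ∉ nbrs x.1 := fun h => hfar (cubeAdj_of_eq_or_mem_nbrs (Or.inr h))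
  rw [NE7K1LinWalkLineCoarse.runB_toBlocks₁₁_eq hn hR' (0 : ℝ), Matrix.add_apply, Matrix.smul_apply, smul_eq_mul]
  have hA : runA n L (0 : ℝ) R' x y = 0 := by
    have hyx : y ≠ x := Ne.symm hxy
    simp [runA, fineOpR, regionOpR, Matrix.of_apply, neumannLapR, diagK, avgK, hyx, hnb]
  have hlap : Beta.CombesThomasForm.lap (adjC n (R'.image (blk L))) x y = 0 := by
    rw [Beta.CombesThomasForm.lap_apply, if_neg hxy, zero_sub, neg_eq_zero]
    exact if_neg hnb
  rw [hA, hlap, mul_zero, add_zero]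

include hn hR' in
/-- **`K_L` IS EXPONENTIALLY LOCALISED, MESH-UNIFORMLY (lens 2's I3 at one scale)**: at `a = 0`, run B's Schur complement onto block means
`K_L = twoCutoffLine … n 0 1` (the effective operator of `L^{2−(d+1)}(−Δ^{η_B})` on the `η_A` lattice, a second-order operator with
`O(n²)` entries) satisfies, for `θ ≥ 0` with `16(d+1)²L^{d+3}(e^θ − 1) ≤ 1` and coarse sites at sup-distance `≥ 2`,
`|K_L(x,y)| ≤ n²·64(d+1)²·9^{d+1}·L^{d+5}·e^{−θ(|x − y|_∞ − 2)}` — rate and prefactor∕n² FREE of the mesh. [folklore] -/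
theorem twoCutoffLine_one_entry_decay {θ : ℝ} (hθ : 0 ≤ θ)
    (hθs : 16 * ((d : ℝ) + 1) ^ 2 * (L : ℝ) ^ (d + 3) * (Real.exp θ - 1) ≤ 1) (x y : ↥(R'.image (blk L)))
    (hfar : ¬ ∀ μ, |x.1 μ - y.1 μ| ≤ 1) :
    |twoCutoffLine (isBlockUnion_fine hR') n (0 : ℝ) 1 x y| ≤
      (n : ℝ) ^ 2 * (64 * ((d : ℝ) + 1) ^ 2 * (9 : ℝ) ^ (d + 1) * (L : ℝ) ^ (d + 5)) *
        Real.exp (-(θ * (supNorm (x.1 - y.1) - 2))) := by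
  rw [twoCutoffLine_one, Matrix.sub_apply, toBlocks₁₁_eq_zero_of_far hn hR' x y hfar, zero_sub, abs_neg]
  exact schur_correction_entry_decay hn hR' le_rfl hθ hθs x y

/-- **THE RATE `θ_K(d,L) = log(1 + 1∕(16(d+1)²L^{d+3}))` IS ADMISSIBLE** (non-vacuity of the rate condition, strictly positive rate). [folklore] -/
theorem thetaK_admissible (d L : ℕ) [NeZero L] :
    0 < Real.log (1 + 1 / (16 * ((d : ℝ) + 1) ^ 2 * (L : ℝ) ^ (d + 3))) ∧
      16 * ((d : ℝ) + 1) ^ 2 * (L : ℝ) ^ (d + 3) * (Real.exp (Real.log (1 + 1 / (16 * ((d : ℝ) + 1) ^ 2 * (L : ℝ) ^ (d + 3)))) - 1) ≤ 1 := by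
  have hL0 : (0 : ℝ) < L := by exact_mod_cast (NeZero.one_le : 1 ≤ L)
  have hc : 0 < 16 * ((d : ℝ) + 1) ^ 2 * (L : ℝ) ^ (d + 3) := by positivity
  refine ⟨Real.log_pos (by have := one_div_pos.2 hc; linarith), ?_⟩
  rw [Real.exp_log (by positivity), add_sub_cancel_left, mul_one_div_cancel hc.ne']

end Schur

end Summit.QuantumFields.BalabanUV.T4Continuum.NE7K1LinSchurKernelDecay

end
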